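import Summits.AtomisticToContinuum.BoseEinsteinCondensation.Theses.BECRewardDescent
import Summits.AtomisticToContinuum.BoseEinsteinCondensation.Theorems.BECRewardDescentCondensedTrialState

/-!
# Route `BECRewardDescent`, crux `RewardScaleChord` (stmt-AtomisticToContinuum-12877),
# line registered (`Lines/birth.lean`): the registered stub `stub_rewardUpper`

Supports (does not close) stmt-AtomisticToContinuum-12877; stub `stub_rewardUpper` of the birth
line (the TRIAL-STATE SIDE of the chord estimate).

**The reward functional on the condensed trial state.** For every repulsive finite-range `v` and
every `η > 0` there is `ρ₀ > 0` such that for `0 < ρ < ρ₀`, eventually in `N` (torus of side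
`L = sideLength ρ N = (N/ρ)^{1/3}`), and every reward `s ≥ 0`,

`R(s) := ⨅_Ψ (⟨Ψ, HΨ⟩ + s · (N − n₀(Ψ))) ≤ 4πaρ(1+η)N + sηN`

(`a = (scatteringLength v).toReal`, `n₀ = condensateOccupation`, the subtraction truncated in
`ℝ≥0∞`).  The proof evaluates the functional at the state `Φ` of the PROVED support item
`CondensedTrialState` (`condensedTrialState_proof`: `⟨Φ, HΦ⟩ ≤ 4πaρ(1+η)N` and
`n₀(Φ) ≥ (1−η)N`): `R(s) ≤ F_s(Φ)` by `iInf_le`, and `N − n₀(Φ) ≤ ηN` in `ℝ≥0∞` because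
`N = ofReal (ηN + (1−η)N) ≤ ofReal (ηN) + ofReal ((1−η)N) ≤ ofReal (ηN) + n₀(Φ)`
(`ENNReal.ofReal_add_le` holds for all reals, so `η > 1` needs no case split).

## References

* E. H. Lieb, R. Seiringer, J. P. Solovej, J. Yngvason, *The Mathematics of the Bose Gas and its
  Condensation* (2005), Thm. 2.2 and its proof (the Dyson–Jastrow trial state).
  [cite: LSSY2005, Thm. 2.2]
-/

noncomputable section

open MeasureTheory Filter
open scoped ENNReal

namespace Summit.AtomisticToContinuum.BoseEinsteinCondensation.Theorems.RewardScaleChord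

open Literature.MathematicalPhysics.QuantumManyBody.BoseGas

namespace RewardUpper

/-- The `ℝ≥0∞` depletion bound: if `ofReal ((1 - η) N) ≤ n₀` then the truncated difference
`(N : ℝ≥0∞) - n₀` is at most `ofReal (η N)` (no sign condition on `η` or `1 - η`). [folklore] -/
theorem natCast_tsub_le_of_le {η : ℝ} {N : ℕ} {n₀ : ℝ≥0∞}
    (hC : ENNReal.ofReal ((1 - η) * N) ≤ n₀) :
    (N : ℝ≥0∞) - n₀ ≤ ENNReal.ofReal (η * N) := by
  rw [tsub_le_iff_right]
  calc (N : ℝ≥0∞) = ENNReal.ofReal (η * N + (1 - η) * N) := by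
        rw [← ENNReal.ofReal_natCast]; congr 1; ring
    _ ≤ ENNReal.ofReal (η * N) + ENNReal.ofReal ((1 - η) * N) := ENNReal.ofReal_add_le
    _ ≤ ENNReal.ofReal (η * N) + n₀ := add_le_add le_rfl hC

/-- The reward term on a condensed state: if `ofReal ((1 - η) N) ≤ n₀` and `s ≥ 0` then
`ofReal s * ((N : ℝ≥0∞) - n₀) ≤ ofReal (s η N)`. [folklore] -/
theorem reward_term_le {s η : ℝ} (hs : 0 ≤ s) {N : ℕ} {n₀ : ℝ≥0∞}
    (hC : ENNReal.ofReal ((1 - η) * N) ≤ n₀) :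
    ENNReal.ofReal s * ((N : ℝ≥0∞) - n₀) ≤ ENNReal.ofReal (s * η * N) := by
  calc ENNReal.ofReal s * ((N : ℝ≥0∞) - n₀)
      ≤ ENNReal.ofReal s * ENNReal.ofReal (η * N) := mul_le_mul_right (natCast_tsub_le_of_le hC) _
    _ = ENNReal.ofReal (s * η * N) := by rw [← ENNReal.ofReal_mul hs, mul_assoc]

end RewardUpper

/-! ### The stub -/

open RewardUpper in
/-- **Stub `stub_rewardUpper` of the birth line — the reward functional on the condensed trial
state.** For every repulsive finite-range `v` and `η > 0` there is `ρ₀ > 0` such that for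
`0 < ρ < ρ₀`, eventually in `N`, for every `s ≥ 0`, on the torus of side `sideLength ρ N`
(written out in place of the crux's `let L := sideLength ρ N`, to which it is zeta-equal),
`⨅_Ψ (periodicEnergy v Ψ + ofReal s * (N - condensateOccupation Ψ))` is at most
`ofReal (4πaρ(1+η)N) + ofReal (sηN)`.
Proof: evaluate at the state `Φ` of `condensedTrialState_proof` (`iInf_le_of_le`), bound the energy
by its first conjunct and the reward term by `reward_term_le` from its second conjunct.
[cite: LSSY2005, Thm. 2.2] -/
theorem stub_rewardUpper :
    ∀ v : ℝ → ENNReal, Literature.MathematicalPhysics.QuantumManyBody.BoseGas.IsRepulsiveFiniteRange v → ∀ η : ℝ, 0 < η → ∃ ρ₀ : ℝ, 0 < ρ₀ ∧ ∀ ρ : ℝ, 0 < ρ → ρ < ρ₀ → ∀ᶠ N : ℕ in Filter.atTop, ∀ s : ℝ, 0 ≤ s → (⨅ Ψ : Literature.MathematicalPhysics.QuantumManyBody.BoseGas.PeriodicTrialState N (Literature.MathematicalPhysics.QuantumManyBody.BoseGas.sideLength ρ N), (Literature.MathematicalPhysics.QuantumManyBody.BoseGas.periodicEnergy v Ψ +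 ENNReal.ofReal s * ((N : ENNReal) - Literature.MathematicalPhysics.QuantumManyBody.BoseGas.condensateOccupation N (Literature.MathematicalPhysics.QuantumManyBody.BoseGas.sideLength ρ N) Ψ.ψ))) ≤ ENNReal.ofReal (4 * Real.pi * (Literature.MathematicalPhysics.QuantumManyBody.BoseGas.scatteringLength v).toReal * ρ * (1 + η) * N) + ENNReal.ofReal (s * η * N) := by
  intro v hv η hη
  obtain ⟨ρ₀, hρ₀, H⟩ :=
    Summit.AtomisticToContinuum.BoseEinsteinCondensation.Theorems.condensedTrialState_proof
      v hv η hη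
  refine ⟨ρ₀, hρ₀, fun ρ hρ hρlt => ?_⟩
  filter_upwards [H ρ hρ hρlt] with N hN
  intro s hs
  dsimp only at hN
  obtain ⟨Φ, hE, hC⟩ := hN
  exact iInf_le_of_le Φ (add_le_add hE (reward_term_le hs hC))

end Summit.AtomisticToContinuum.BoseEinsteinCondensation.Theorems.RewardScaleChord

end
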